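import Mathlib
import Summits.Ventures.PercRepro2.ThreeTermPinnedTermEdges
import Summits.Ventures.PercRepro2.ThreeTermPinnedCube
import Summits.Ventures.PercRepro2.ThreeTermJoinLaw

/-!
# Three-terminal parts, VI g: (2′TRI-PINPART⁺) — the typed edges of one unmarked three-terminal part
PLUS any typed edges between its terminals, on any pinned background
(blind cell PercRepro2, night-3 g31, 2026-08-30; `proofs/NIGHT3-CERT.md` §40.10)

ThreeTermPinnedPart.lean proves row 2′TRI when the typed edges are exactly the edges of one part.  Here
the core may also carry TYPED EDGES BETWEEN THE TERMINALS (`TermEdges`: a finset `F` of edges, each with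
ends two distinct terminals; any types, any multiplicity).  An open terminal edge acts on connectivity
exactly like the virtual edge of its pair, so a pattern configuration with `F` assigned has the
connectivity of the triangle at the COMBINED pattern `patX` over the background with `S ∪ F` closed
(`conn_terminal_edges_iff`, ThreeTermPinnedTermEdges.lean), and its state is the abstract state of the
background's labeling at that pattern (`st_terminal_edges`, then `st_eq_stAbs`).  The table is the sum
over the typed assignments of `F` of `KB` at such states (`typedCount3_eq_sum_setOn`), and the
symmetrisation over the three copies permutes the assignments along (`typed_swap12/23`), so every term
of the symmetrised table is a `symKBS` of three abstract states of ONE labeling — nonnegative by the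
kernel checks (`symKBS_nonneg_rep`, `stAbs_rep8`).

**`typedCount_nonneg_pinned_part_plus`**: `0 ≤ typedCount (F ∪ S) z τ K₃` for every part `W` at
`(t₁, t₂, t₃)` with edge set `S`, every finset `F` of edges between the terminals, every pinning and
every type map.  Own work; standard axioms.
-/

namespace Summit.Ventures.PercRepro2

open Block ThreeTerm TypedStar CovForm CovForm.OneTyped

namespace Part

/-! ## The state through the combined pattern, and the theorem -/

section MainPlus

open Classical

variable {V : Type*} {E : Type*} [Fintype E] [DecidableEq E]

omit [Fintype E] in
/-- The background of a pattern configuration with `F` assigned is the background of `z`. -/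
lemma bg_setOn (S F : Finset E) (e₁ e₂ e₃ : E) (z a : Config E) (i : Fin 8) :
    bg S F (setOn F a (setOn S (cfg e₁ e₂ e₃ i) z)) = bg S F z := by
  funext e
  simp only [bg]
  by_cases he : e ∈ S ∪ F
  · rw [if_pos he, if_pos he]
  · rw [if_neg he, if_neg he]
    have heF : e ∉ F := fun h => he (Finset.mem_union_right _ h)
    have heS : e ∉ S := fun h => he (Finset.mem_union_left _ h)
    rw [setOn_of_not_mem heF, setOn_of_not_mem heS]

omit [Fintype E] in
/-- The background is closed on `S`: overwriting `S` by the empty pattern changes nothing. -/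
lemma setOn_cfg0_bg (S F : Finset E) (e₁ e₂ e₃ : E) (x : Config E) :
    setOn S (cfg e₁ e₂ e₃ 0) (bg S F x) = bg S F x := by
  funext e
  by_cases he : e ∈ S
  · rw [setOn_of_mem he]
    have : cfg e₁ e₂ e₃ (0 : Fin 8) e = false := by
      simp only [cfg]; split_ifs <;> simp [bit]
    rw [this]
    simp only [bg, Finset.mem_union, he, true_or, if_true]
  · rw [setOn_of_not_mem he]

omit [Fintype E] in
/-- **The state of a configuration with terminal edges** is the abstract state of the background's
labeling at the combined pattern. -/
theorem st_terminal_edges (ends : E → Sym2 V) (S F : Finset E) (hd : Disjoint F S) (t₁ t₂ t₃ : V)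
    (hF : TermEdges ends t₁ t₂ t₃ F) {e₁ e₂ e₃ : E} (h1 : e₁ ∈ S) (h2 : e₂ ∈ S) (h3 : e₃ ∈ S)
    (h12 : e₁ ≠ e₂) (h13 : e₁ ≠ e₃) (h23 : e₂ ≠ e₃) (o a₁ a₂ a₃ b : V) (x : Config E)
    (hQ : ¬ Conn (partEnds ends (↑S) e₁ e₂ e₃ t₁ t₂ t₃) (bg S F x) a₁ a₂) :
    st (partEnds ends (↑S) e₁ e₂ e₃ t₁ t₂ t₃) o a₁ a₂ a₃ b x =
      stAbs (labOf (partEnds ends (↑S) e₁ e₂ e₃ t₁ t₂ t₃) (bg S F x) a₁ a₂ (pt o b a₃ t₁ t₂ t₃))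
        (patX (partEnds ends (↑S) e₁ e₂ e₃ t₁ t₂ t₃) S F t₁ t₂ t₃ x) := by
  have hc := conn_terminal_edges_iff ends S F hd t₁ t₂ t₃ hF h1 h2 h3 h12 h13 h23 x
  have e1 : st (partEnds ends (↑S) e₁ e₂ e₃ t₁ t₂ t₃) o a₁ a₂ a₃ b x =
      st (partEnds ends (↑S) e₁ e₂ e₃ t₁ t₂ t₃) o a₁ a₂ a₃ b
        (setOn S (cfg e₁ e₂ e₃ (patX (partEnds ends (↑S) e₁ e₂ e₃ t₁ t₂ t₃) S F t₁ t₂ t₃ x)) (bg S F x)) := by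
    unfold st
    simp only [hc]
  rw [e1]
  have hQ' : ¬ Conn (partEnds ends (↑S) e₁ e₂ e₃ t₁ t₂ t₃) (setOn S (cfg e₁ e₂ e₃ 0) (bg S F x)) a₁ a₂ := by
    rw [setOn_cfg0_bg]; exact hQ
  have := st_eq_stAbs ends S h1 h2 h3 h12 h13 h23 o a₁ a₂ a₃ b t₁ t₂ t₃ (bg S F x) hQ'
    (patX (partEnds ends (↑S) e₁ e₂ e₃ t₁ t₂ t₃) S F t₁ t₂ t₃ x)
  rw [setOn_cfg0_bg] at this
  exact this

/-- Swapping the first two copies in a typed assignment sum. -/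
lemma tsum_swap12 (F : Finset E) (τ : E → ℕ) (g : Config E → Config E → Config E → ℚ) :
    (∑ a : Config E, ∑ b : Config E, ∑ c : Config E,
        if (SuppOn F a ∧ SuppOn F b ∧ SuppOn F c) ∧ (∀ e ∈ F, openCount a b c e = τ e)
          then g a b c else 0) =
      ∑ a : Config E, ∑ b : Config E, ∑ c : Config E,
        if (SuppOn F a ∧ SuppOn F b ∧ SuppOn F c) ∧ (∀ e ∈ F, openCount a b c e = τ e)
          then g b a c else 0 := by
  rw [Finset.sum_comm]
  refine Finset.sum_congr rfl fun b _ => Finset.sum_congr rfl fun a _ => Finset.sum_congr rfl fun c _ => ?_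
  rw [if_congr (typed_swap12 F τ a b c) rfl rfl]

/-- Swapping the last two copies in a typed assignment sum. -/
lemma tsum_swap23 (F : Finset E) (τ : E → ℕ) (g : Config E → Config E → Config E → ℚ) :
    (∑ a : Config E, ∑ b : Config E, ∑ c : Config E,
        if (SuppOn F a ∧ SuppOn F b ∧ SuppOn F c) ∧ (∀ e ∈ F, openCount a b c e = τ e)
          then g a b c else 0) =
      ∑ a : Config E, ∑ b : Config E, ∑ c : Config E,
        if (SuppOn F a ∧ SuppOn F b ∧ SuppOn F c) ∧ (∀ e ∈ F, openCount a b c e = τ e)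
          then g a c b else 0 := by
  refine Finset.sum_congr rfl fun a _ => ?_
  rw [Finset.sum_comm]
  refine Finset.sum_congr rfl fun c _ => Finset.sum_congr rfl fun b _ => ?_
  rw [if_congr (typed_swap23 F τ a b c) rfl rfl]

/-- **The six copy-permuted typed sums add up to the typed sum of the symmetrised kernel** (for any
state-valued function of the pattern and the assignment). -/
lemma symm6_typed (F : Finset E) (τ : E → ℕ) (s : Fin 8 → Config E → St) (i j k : Fin 8) :
    (∑ a : Config E, ∑ b : Config E, ∑ c : Config E,
        if (SuppOn F a ∧ SuppOn F b ∧ SuppOn F c) ∧ (∀ e ∈ F, openCount a b c e = τ e)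
          then ((KB (s i a) (s j b) (s k c) : ℤ) : ℚ) else 0) +
      (∑ a : Config E, ∑ b : Config E, ∑ c : Config E,
        if (SuppOn F a ∧ SuppOn F b ∧ SuppOn F c) ∧ (∀ e ∈ F, openCount a b c e = τ e)
          then ((KB (s i a) (s k b) (s j c) : ℤ) : ℚ) else 0) +
      (∑ a : Config E, ∑ b : Config E, ∑ c : Config E,
        if (SuppOn F a ∧ SuppOn F b ∧ SuppOn F c) ∧ (∀ e ∈ F, openCount a b c e = τ e)
          then ((KB (s j a) (s i b) (s k c) : ℤ) : ℚ) else 0) +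
      (∑ a : Config E, ∑ b : Config E, ∑ c : Config E,
        if (SuppOn F a ∧ SuppOn F b ∧ SuppOn F c) ∧ (∀ e ∈ F, openCount a b c e = τ e)
          then ((KB (s j a) (s k b) (s i c) : ℤ) : ℚ) else 0) +
      (∑ a : Config E, ∑ b : Config E, ∑ c : Config E,
        if (SuppOn F a ∧ SuppOn F b ∧ SuppOn F c) ∧ (∀ e ∈ F, openCount a b c e = τ e)
          then ((KB (s k a) (s i b) (s j c) : ℤ) : ℚ) else 0) +
      (∑ a : Config E, ∑ b : Config E, ∑ c : Config E,
        if (SuppOn F a ∧ SuppOn F b ∧ SuppOn F c) ∧ (∀ e ∈ F, openCount a b c e = τ e)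
          then ((KB (s k a) (s j b) (s i c) : ℤ) : ℚ) else 0) =
    ∑ a : Config E, ∑ b : Config E, ∑ c : Config E,
      if (SuppOn F a ∧ SuppOn F b ∧ SuppOn F c) ∧ (∀ e ∈ F, openCount a b c e = τ e)
        then ((symKBS (s i a) (s j b) (s k c) : ℤ) : ℚ) else 0 := by
  have e2 := tsum_swap23 F τ (fun a b c => ((KB (s i a) (s k b) (s j c) : ℤ) : ℚ))
  have e3 := tsum_swap12 F τ (fun a b c => ((KB (s j a) (s i b) (s k c) : ℤ) : ℚ))
  have e4 := (tsum_swap23 F τ (fun a b c => ((KB (s j a) (s k b) (s i c) : ℤ) : ℚ))).trans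
    (tsum_swap12 F τ (fun a b c => ((KB (s j a) (s k c) (s i b) : ℤ) : ℚ)))
  have e5 := (tsum_swap12 F τ (fun a b c => ((KB (s k a) (s i b) (s j c) : ℤ) : ℚ))).trans
    (tsum_swap23 F τ (fun a b c => ((KB (s k b) (s i a) (s j c) : ℤ) : ℚ)))
  have e6 := ((tsum_swap12 F τ (fun a b c => ((KB (s k a) (s j b) (s i c) : ℤ) : ℚ))).trans
    (tsum_swap23 F τ (fun a b c => ((KB (s k b) (s j a) (s i c) : ℤ) : ℚ)))).trans
    (tsum_swap12 F τ (fun a b c => ((KB (s k c) (s j a) (s i b) : ℤ) : ℚ)))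
  rw [e2, e3, e4, e5, e6]
  simp only [← Finset.sum_add_distrib]
  refine Finset.sum_congr rfl fun a _ => Finset.sum_congr rfl fun b _ => Finset.sum_congr rfl fun c _ => ?_
  split_ifs
  · unfold symKBS; push_cast; ring
  · simp

/-- **ROW 2′TRI FOR THE TYPED EDGES OF ONE UNMARKED THREE-TERMINAL PART PLUS ANY TYPED EDGES BETWEEN
ITS TERMINALS**, on any pinned background. -/
theorem typedCount_nonneg_pinned_part_plus {ends : E → Sym2 V} {W : Set V} {t₁ t₂ t₃ : V}
    (hW : IsPart ends W t₁ t₂ t₃) {S : Finset E} (hS : ∀ e, e ∈ S ↔ e ∈ touches ends W)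
    {e₁ e₂ e₃ : E} (h1 : e₁ ∈ S) (h2 : e₂ ∈ S) (h3 : e₃ ∈ S) (h12 : e₁ ≠ e₂) (h13 : e₁ ≠ e₃)
    (h23 : e₂ ≠ e₃) {o a₁ a₂ a₃ b : V} (ho : o ∉ W) (ha₁ : a₁ ∉ W) (ha₂ : a₂ ∉ W) (ha₃ : a₃ ∉ W)
    (hb : b ∉ W) {F : Finset E} (hd : Disjoint F S) (hF : TermEdges ends t₁ t₂ t₃ F) (z : Config E)
    (τ : E → ℕ) :
    0 ≤ typedCount (F ∪ S) z τ (CovForm.K3 (R := ℚ) ends o a₁ a₂ a₃ b) := by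
  rw [typedCount_part_eq hW hS h1 h2 h3 h12 h13 h23 ho ha₁ ha₂ ha₃ hb hd z τ]
  set G' := partEnds ends (↑S) e₁ e₂ e₃ t₁ t₂ t₃ with hG'
  set n := partLaw S τ (pat ends S e₁ e₂ e₃ t₁ t₂ t₃) with hn
  have hsym : Sym3 n := partLaw_sym S τ _
  have hnn : ∀ i j k, 0 ≤ n i j k := partLaw_nonneg S τ _
  -- the configurations of the table: pattern `q`, assignment `a` on `F`
  set cf : Fin 8 → Config E → Config E := fun q a => setOn F a (setOn S (cfg e₁ e₂ e₃ q) z) with hcf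
  have hT : ∀ i j k : Fin 8, partTable ends S e₁ e₂ e₃ t₁ t₂ t₃ o a₁ a₂ a₃ b F z τ i j k =
      ∑ a : Config E, ∑ b' : Config E, ∑ c : Config E,
        if (SuppOn F a ∧ SuppOn F b' ∧ SuppOn F c) ∧ (∀ e ∈ F, openCount a b' c e = τ e) then
          ((KB (st G' o a₁ a₂ a₃ b (cf (rep8 i) a)) (st G' o a₁ a₂ a₃ b (cf (rep8 j) b'))
            (st G' o a₁ a₂ a₃ b (cf (rep8 k) c)) : ℤ) : ℚ) else 0 := by
    intro i j k
    rw [partTable_rep ends S h1 h2 h3 h12 h13 h23 t₁ t₂ t₃ o a₁ a₂ a₃ b hd z τ i j k]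
    unfold partTable
    rw [typedCount3_eq_sum_setOn]
    refine Finset.sum_congr rfl fun a _ => Finset.sum_congr rfl fun b' _ => Finset.sum_congr rfl fun c _ => ?_
    split_ifs
    · exact K3_eq_KB G' o a₁ a₂ a₃ b _ _ _
    · rfl
  simp only [hT]
  by_cases hQ : Conn G' (bg S F z) a₁ a₂
  · -- every configuration is off `Q`
    have hq : ∀ (q : Fin 8) (a : Config E), (st G' o a₁ a₂ a₃ b (cf q a)).q' = true := by
      intro q a
      show decide (Conn G' (cf q a) a₂ a₁) = true
      rw [decide_eq_true_iff]
      have hle : bg S F z ≤ cf q a := by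
        rw [← bg_setOn S F e₁ e₂ e₃ z a q]
        exact bg_le S F _
      exact conn_symm (conn_mono hle hQ)
    refine Finset.sum_nonneg fun i _ => Finset.sum_nonneg fun j _ => Finset.sum_nonneg fun k _ => ?_
    refine mul_nonneg (hnn i j k) ?_
    refine Finset.sum_nonneg fun a _ => Finset.sum_nonneg fun b' _ => Finset.sum_nonneg fun c _ => ?_
    split_ifs
    · rw [KB_eq_zero_of_q' _ _ _ (Or.inl (hq (rep8 i) a))]; simp
    · exact le_refl 0
  · -- the abstract states of the background's labeling
    set f := labOf G' (bg S F z) a₁ a₂ (pt o b a₃ t₁ t₂ t₃) with hf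
    have hst : ∀ (q : Fin 8) (a : Config E), st G' o a₁ a₂ a₃ b (cf q a) =
        stAbs f (patX G' S F t₁ t₂ t₃ (cf q a)) := by
      intro q a
      have hQ' : ¬ Conn G' (bg S F (cf q a)) a₁ a₂ := by rw [hcf, bg_setOn]; exact hQ
      have := st_terminal_edges ends S F hd t₁ t₂ t₃ hF h1 h2 h3 h12 h13 h23 o a₁ a₂ a₃ b (cf q a) hQ'
      rw [hcf, bg_setOn] at this
      rw [hcf]; exact this
    simp only [hst]
    have hbd : ∀ v, (f v).val ≤ v.val + 2 := labOf_le G' _ a₁ a₂ _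
    have hg : Guard f = true := guard_labOf G' _ a₁ a₂ _ hQ
    -- the states as a function of the pattern and the assignment
    set s : Fin 8 → Config E → St := fun q a => stAbs f (patX G' S F t₁ t₂ t₃ (cf q a)) with hs
    have hs' : ∀ q a, stAbs f (patX G' S F t₁ t₂ t₃ (cf q a)) = s q a := fun q a => rfl
    simp only [hs']
    set T : Fin 8 → Fin 8 → Fin 8 → ℚ := fun i j k =>
      ∑ a : Config E, ∑ b' : Config E, ∑ c : Config E,
        if (SuppOn F a ∧ SuppOn F b' ∧ SuppOn F c) ∧ (∀ e ∈ F, openCount a b' c e = τ e) then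
          ((KB (s (rep8 i) a) (s (rep8 j) b') (s (rep8 k) c) : ℤ) : ℚ) else 0 with hTdef
    have hpos : ∀ i j k, 0 ≤ T i j k + T i k j + T j i k + T j k i + T k i j + T k j i := by
      intro i j k
      have h6 := symm6_typed F τ s (rep8 i) (rep8 j) (rep8 k)
      simp only [hTdef]
      rw [h6]
      refine Finset.sum_nonneg fun a _ => Finset.sum_nonneg fun b' _ => Finset.sum_nonneg fun c _ => ?_
      split_ifs
      · have hsn := symKBS_nonneg_rep f hbd hg (patX G' S F t₁ t₂ t₃ (cf (rep8 i) a))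
          (patX G' S F t₁ t₂ t₃ (cf (rep8 j) b')) (patX G' S F t₁ t₂ t₃ (cf (rep8 k) c))
        rw [← stAbs_rep8, ← stAbs_rep8, ← stAbs_rep8] at hsn
        exact_mod_cast hsn
      · exact le_refl 0
    have key : 0 ≤ 6 * (∑ i : Fin 8, ∑ j : Fin 8, ∑ k : Fin 8, n i j k * T i j k) := by
      rw [sum_sym6 hsym T]
      exact Finset.sum_nonneg fun i _ => Finset.sum_nonneg fun j _ => Finset.sum_nonneg fun k _ =>
        mul_nonneg (hnn i j k) (hpos i j k)
    have : (∑ i : Fin 8, ∑ j : Fin 8, ∑ k : Fin 8, n i j k * T i j k) =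
        ∑ i : Fin 8, ∑ j : Fin 8, ∑ k : Fin 8, n i j k *
          ∑ a : Config E, ∑ b' : Config E, ∑ c : Config E,
            if (SuppOn F a ∧ SuppOn F b' ∧ SuppOn F c) ∧ (∀ e ∈ F, openCount a b' c e = τ e) then
              ((KB (s (rep8 i) a) (s (rep8 j) b') (s (rep8 k) c) : ℤ) : ℚ)
            else 0 := rfl
    rw [this] at key
    linarith

end MainPlus


end Part

end Summit.Ventures.PercRepro2
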